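import Summits.QuantumFields.Balaban3D.Carriers.RadialContour
import Literature.MathematicalPhysics.QuantumFieldTheory.Balaban1983to89.B5Eq118OneStroke
import Literature.MathematicalPhysics.QuantumFieldTheory.Balaban1983to89.B15DeterminingSets
import HarnessLib

/-!
# N07 [B11] (= [15] = [Balaban1985Variational]) Sect. F ∕ [6] (1.15)∕(1.19) — **ON THE TORUS: THE TRANSFORMATION `τ = g₁·g₂⁻¹` BETWEEN TWO GAUGES OF ONE CONFIGURATION IS POINTWISE
# MULTISCALE-REGULAR WHEN BOTH AVERAGED TOWERS HAVE SMALL RADIAL TREE-TRANSPORTER DEFECTS** — the TORUS twin of this seat's ✓p754021 `B8TwoAxialGaugesOscillationRec` (there on `ℤᵈ`),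
# indexed by FINE sites so that no block geometry is needed; generic `Params`, ANY gauge group (`dist1` currency)

Cell `pub-ymgap`, width seat `pub-ymgap-dag-n07-w3` g13 (junction side of the K0 road; (σ2)).  `--kind proof --supports stmt-QuantumFields-20541 --as helper` (K0⁷; count-neutral; THEOREMS
ONLY, 0 `def`; Summits-side because `radialHol` is `Summit.QuantumFields.Balaban3D.Carriers`).  [6] = [Balaban1985RegularSpaces]; [3] = [Balaban1985Averaging]; [I] = [Balaban1987RG1];
[15] = [Balaban1985Variational].  CONSUMED BY NAME: pub-balaban3d's `Carriers.RadialContour.{radialHol, radialHol_gaugeAct}`, NODE 00's `T4Continuum.{transfUp, iter_gaugeAct}` ([3] (11)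
iterated), `B15DeterminingSets.embIter`, `B5Eq118OneStroke.iterBlockOf`, `Setup.GaugeGroup.{dist1_mul_le, dist1_inv, dist1_conj, dist1_one}`.

WHY (the junction's (σ2), torus leg).  Road (B′)'s first factor is the lift of the TORUS transformation `τ_T := (h̄_s·w_s)·(h̄_r·w_r)⁻¹` between the def of record's `symCd`-axial
tower and N07's radial tower (g10 ✓`…N07TowerGaugeCoverLift`: the crown's `vfix` IS the lift of `h̄_r·w_r`).  Pointwise values transcribe to the cover with NO averaging dictionary, so
it suffices to control `τ_T` POINTWISE on the torus: at the centre `embIter (n+1) yy` of a block versus the centres `embIter n x` of its block sites, then down the tower.  By [3] (11)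
(`iter_gaugeAct`: `M^n(U^g) = (M^n U)^{g∘embIter n}`) and the covariance of the radial contour (`radialHol_gaugeAct`), `A_k := M^n(U^{g_k})(Γ_{yy,x}) = g_k(embIter (n+1) yy)·M^nU(Γ_{yy,x})·
g_k(embIter n x)⁻¹`, whence EXACTLY `τ(embIter (n+1) yy)⁻¹·τ(embIter n x) = A₂·σ·A₁⁻¹·σ⁻¹` (`σ = g₂g₁⁻¹` at `embIter n x`): one level costs `dist1 A₂ + dist1 A₁` (`dist1` subadditive and
conjugation invariant), and along the block tower of a FINE site `w` (`x_n := iterBlockOf n w`) the costs telescope.  The radial tower gives `dist1 A₂ = 0` (`AxialGauge radialContourData`),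
the symmetric one `dist1 A₁ ≤ 8σ′(a(n))` (this seat's p755647 `…N07SymAxialRadialDefectOfBoxPlaquettes`).

WHAT IS PROVED (sorry-free; any `GaugeGroup G`, any averaging family `av`, standing range `n + 1 ≤ m + K`).
§1 private `transfUp_eq_embIter` (as in UST's `…Prop7FlatHolonomy`), ★ `radialHol_iter_gaugeAct` (the covariance formula for `A_k`).
§2 ★★ `dist1_step_le` (one level: `dist1 (τ(embIter (n+1) yy)⁻¹·τ(embIter n x)) ≤ dist1 A₂ + dist1 A₁`).
§3 ★★★ `dist1_descent_le` — for a set `S` of fine sites and per-level defects `δ₁ n`, `δ₂ n` holding at the tower `(iterBlockOf (n+1) w, iterBlockOf n w)` of every `w ∈ S`: for `t ≤ k ≤ m + K`,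
   `dist1 (τ(embIter t (iterBlockOf t w))⁻¹·τ(w)) ≤ Σ_{m<t} (δ₂ m + δ₁ m)`; ★★★ `dist1_descent_le_geom` (geometric defects `δ₂ m + δ₁ m ≤ (ω∕2)·θ^{k−(m+1)}`, `θ ≤ 1∕2` ⇒ `≤ ω·θ^{k−t}`).
HONEST FRAMING: count-neutral helper; exact covariance bookkeeping + a telescoping sum — nothing of [6]∕[3]∕[I]∕[15] asserted or discharged; the defect INPUTS and the pointwise cover
transcription to the `ℤᵈ` shape of ✓p753816 are the knit's; `NrmSymPhiOfRecord` ∕ `HThm4RecSym152PhiE(G)` ∕ `HThm4Rec*` UNDISCHARGED; N05 ∕ N07 NOT discharged; K0⁷ ∕ K1⁹ NOT closed; counts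
unmoved (typed 28∕28 · discharged 8∕28); one finite 𝕋⁴ programme at fixed ε — R4 closes the conditional finite-𝕋⁴ rung `BalabanLadder.UV` only; the YM mass gap (Clay) is NOT proved by any
of this; nothing continuum ∕ ℝ⁴ ∕ OS.  No `def`, no `instance`, no `notation`, no `sorry`.

References: [6] (1.15) p. 78, (1.19) p. 79, (1.132) p. 99; [3] (8) p. 18, (11) p. 19; [I] (0.1) p. 251, (0.3)–(0.4) pp. 252–253; [15] (147)–(154) pp. 301–302.
-/

set_option autoImplicit false

noncomputable section

open scoped BigOperators

namespace Summit.QuantumFields.YangMills.BalabanUVNodes.N07TwoAxialTowersPointwiseOsc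

open Literature.MathematicalPhysics.QuantumFieldTheory.Balaban1983to89
open T4Continuum (transfUp iter_gaugeAct)
open B15DeterminingSets (embIter)
open B5Eq118OneStroke (iterBlockOf iterBlockOf_zero iterBlockOf_succ)
open Summit.QuantumFields.Balaban3D.Carriers (radialHol radialHol_gaugeAct)
open GaugeField (gaugeAct)

variable {P : Params} {G : Type*} [GaugeGroup G]

/-! ## §1  Covariance bookkeeping -/

omit [GaugeGroup G] in
/-- `u^{(k)}(y) = u(embIter k y)` (both recursions walk down the centres). [cite: Balaban1985Averaging, (11)–(13) p.19 (bookkeeping)] -/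
private theorem transfUp_eq_embIter (u : GaugeTransf P 0 G) : ∀ (k : ℕ) (y : Site P k), transfUp u k y = u (embIter k y)
  | 0, _ => rfl
  | k + 1, y => transfUp_eq_embIter u k (emb y)

/-- ★ **THE RADIAL TREE TRANSPORTER OF AN AVERAGED GAUGE COPY** ([3] (11) iterated + (8) along the radial contour): for `n ≤ m + K`,
`M^n(U^g)(Γ_{yy,x}) = g(embIter (n+1) yy) · M^nU(Γ_{yy,x}) · g(embIter n x)⁻¹`. [cite: Balaban1985Averaging, (8) p.18, (11) p.19; Balaban1987RG1, (0.3)–(0.4) pp.252–253] -/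
theorem radialHol_iter_gaugeAct (av : ∀ j, Averaging P j G) {n : ℕ} (hn : n ≤ P.m + P.K) (g : GaugeTransf P 0 G) (U : GaugeField P 0 G)
    (yy : Site P (n + 1)) (x : Site P n) :
    radialHol (Averaging.iter av n (gaugeAct g U)) yy x = g (embIter (n + 1) yy) * radialHol (Averaging.iter av n U) yy x * (g (embIter n x))⁻¹ := by
  rw [iter_gaugeAct av g n hn U, radialHol_gaugeAct, transfUp_eq_embIter, transfUp_eq_embIter]
  rfl

/-! ## §2  One level -/

/-- ★★ **ONE LEVEL**: with `A_k := M^n(U^{g_k})(Γ_{yy,x})`, the transformation `τ = g₁·g₂⁻¹` satisfies EXACTLY `τ(embIter (n+1) yy)⁻¹·τ(embIter n x) = A₂·(σ·A₁⁻¹·σ⁻¹)`,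
`σ = g₂(embIter n x)·g₁(embIter n x)⁻¹`, hence `dist1 (τ(embIter (n+1) yy)⁻¹·τ(embIter n x)) ≤ dist1 A₂ + dist1 A₁`.
[cite: Balaban1985RegularSpaces, (1.19) p.79; Balaban1985Averaging, (8) p.18, (11) p.19; Balaban1987RG1, (0.4) p.253] -/
theorem dist1_step_le (av : ∀ j, Averaging P j G) {n : ℕ} (hn : n ≤ P.m + P.K) (g₁ g₂ : GaugeTransf P 0 G) (U : GaugeField P 0 G)
    (yy : Site P (n + 1)) (x : Site P n) :
    dist1 ((g₁ (embIter (n + 1) yy) * (g₂ (embIter (n + 1) yy))⁻¹)⁻¹ * (g₁ (embIter n x) * (g₂ (embIter n x))⁻¹)) ≤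
      dist1 (radialHol (Averaging.iter av n (gaugeAct g₂ U)) yy x) + dist1 (radialHol (Averaging.iter av n (gaugeAct g₁ U)) yy x) := by
  set c := embIter (n + 1) yy with hc
  set cx := embIter n x with hcx
  set T := radialHol (Averaging.iter av n U) yy x with hT
  have hA₁ : radialHol (Averaging.iter av n (gaugeAct g₁ U)) yy x = g₁ c * T * (g₁ cx)⁻¹ := radialHol_iter_gaugeAct av hn g₁ U yy x
  have hA₂ : radialHol (Averaging.iter av n (gaugeAct g₂ U)) yy x = g₂ c * T * (g₂ cx)⁻¹ := radialHol_iter_gaugeAct av hn g₂ U yy x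
  have key : (g₁ c * (g₂ c)⁻¹)⁻¹ * (g₁ cx * (g₂ cx)⁻¹) =
      (g₂ c * T * (g₂ cx)⁻¹) * ((g₂ cx * (g₁ cx)⁻¹) * (g₁ c * T * (g₁ cx)⁻¹)⁻¹ * (g₂ cx * (g₁ cx)⁻¹)⁻¹) := by group
  rw [key, ← hA₁, ← hA₂]
  refine (GaugeGroup.dist1_mul_le _ _).trans ?_
  rw [GaugeGroup.dist1_conj, GaugeGroup.dist1_inv]

/-! ## §3  Down the block tower of a fine site -/

/-- ★★★ **DESCENT ALONG THE BLOCK TOWER OF A FINE SITE**: let `S` be a set of fine sites and suppose that for every `n < k` (`k ≤ m + K`) and every `w ∈ S` the radial tree transporters of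
the two averaged gauge copies at `(iterBlockOf (n+1) w, iterBlockOf n w)` have `dist1 ≤ δ₁ n`, `δ₂ n`.  Then for `t ≤ k` and `w ∈ S`:
`dist1 (τ(embIter t (iterBlockOf t w))⁻¹ · τ(w)) ≤ Σ_{m<t} (δ₂ m + δ₁ m)`, `τ = g₁·g₂⁻¹`.
[cite: Balaban1985RegularSpaces, (1.15) p.78, (1.19) p.79, (1.132) p.99; Balaban1985Averaging, (11) p.19; Balaban1987RG1, (0.1) p.251, (0.3)–(0.4) pp.252–253] -/
theorem dist1_descent_le (av : ∀ j, Averaging P j G) {k : ℕ} (hk : k ≤ P.m + P.K) (g₁ g₂ : GaugeTransf P 0 G) (U : GaugeField P 0 G) (S : Set (Site P 0))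
    (δ₁ δ₂ : ℕ → ℝ)
    (h₁ : ∀ n, n < k → ∀ w ∈ S, dist1 (radialHol (Averaging.iter av n (gaugeAct g₁ U)) (iterBlockOf (n + 1) w) (iterBlockOf n w)) ≤ δ₁ n)
    (h₂ : ∀ n, n < k → ∀ w ∈ S, dist1 (radialHol (Averaging.iter av n (gaugeAct g₂ U)) (iterBlockOf (n + 1) w) (iterBlockOf n w)) ≤ δ₂ n) :
    ∀ t, t ≤ k → ∀ w ∈ S,
      dist1 ((g₁ (embIter t (iterBlockOf t w)) * (g₂ (embIter t (iterBlockOf t w)))⁻¹)⁻¹ * (g₁ w * (g₂ w)⁻¹)) ≤ ∑ m ∈ Finset.range t, (δ₂ m + δ₁ m) := by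
  intro t
  induction t with
  | zero =>
    intro _ w _
    simp only [iterBlockOf_zero, Finset.range_zero, Finset.sum_empty]
    rw [show embIter 0 w = w from rfl, inv_mul_cancel, GaugeGroup.dist1_one]
  | succ t ih =>
    intro ht w hw
    have htk : t < k := by omega
    have hstep := dist1_step_le av (by omega : t ≤ P.m + P.K) g₁ g₂ U (iterBlockOf (t + 1) w) (iterBlockOf t w)
    have hih := ih htk.le w hw
    have hsplit : (g₁ (embIter (t + 1) (iterBlockOf (t + 1) w)) * (g₂ (embIter (t + 1) (iterBlockOf (t + 1) w)))⁻¹)⁻¹ * (g₁ w * (g₂ w)⁻¹) =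
        ((g₁ (embIter (t + 1) (iterBlockOf (t + 1) w)) * (g₂ (embIter (t + 1) (iterBlockOf (t + 1) w)))⁻¹)⁻¹ *
            (g₁ (embIter t (iterBlockOf t w)) * (g₂ (embIter t (iterBlockOf t w)))⁻¹)) *
          ((g₁ (embIter t (iterBlockOf t w)) * (g₂ (embIter t (iterBlockOf t w)))⁻¹)⁻¹ * (g₁ w * (g₂ w)⁻¹)) := by group
    rw [hsplit, Finset.sum_range_succ]
    refine (GaugeGroup.dist1_mul_le _ _).trans ?_
    have h1' := h₁ t htk w hw
    have h2' := h₂ t htk w hw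
    linarith

/-- A geometric tail: `Σ_{m<t} θ^{k−(m+1)} ≤ 2·θ^{k−t}` for `t ≤ k`, `0 ≤ θ ≤ 1∕2`. [folklore] -/
private theorem sum_geom_tail_le {θ : ℝ} (hθ0 : 0 ≤ θ) (hθ : θ ≤ 1 / 2) (k : ℕ) :
    ∀ t, t ≤ k → ∑ m ∈ Finset.range t, θ ^ (k - (m + 1)) ≤ 2 * θ ^ (k - t)
  | 0, _ => by rw [Finset.range_zero, Finset.sum_empty]; positivity
  | t + 1, ht => by
    have h := sum_geom_tail_le hθ0 hθ k t (Nat.le_of_succ_le ht)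
    have hpow : θ ^ (k - t) = θ * θ ^ (k - (t + 1)) := by
      rw [← pow_succ', show k - (t + 1) + 1 = k - t by omega]
    rw [Finset.sum_range_succ]
    have h0 : 0 ≤ θ ^ (k - (t + 1)) := pow_nonneg hθ0 _
    nlinarith

/-- ★★★ **GEOMETRIC DEFECTS GIVE GEOMETRIC POINTWISE OSCILLATION**: if `δ₂ m + δ₁ m ≤ (ω∕2)·θ^{k−(m+1)}` for `m < k` (`0 ≤ θ ≤ 1∕2`, `0 ≤ ω`), then for `t ≤ k` and `w ∈ S`:
`dist1 (τ(embIter t (iterBlockOf t w))⁻¹·τ(w)) ≤ ω·θ^{k−t}` — the torus form of the hypothesis `hpt` of ✓p753816 (at `t = i + 1`), to be read on the cover.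
[cite: Balaban1985RegularSpaces, (1.15) p.78, (1.19) p.79; Balaban1985Averaging, (11) p.19; Balaban1987RG1, (0.4) p.253] -/
theorem dist1_descent_le_geom (av : ∀ j, Averaging P j G) {k : ℕ} (hk : k ≤ P.m + P.K) (g₁ g₂ : GaugeTransf P 0 G) (U : GaugeField P 0 G) (S : Set (Site P 0))
    (δ₁ δ₂ : ℕ → ℝ) {ω θ : ℝ} (hθ0 : 0 ≤ θ) (hθ : θ ≤ 1 / 2) (hω0 : 0 ≤ ω)
    (h₁ : ∀ n, n < k → ∀ w ∈ S, dist1 (radialHol (Averaging.iter av n (gaugeAct g₁ U)) (iterBlockOf (n + 1) w) (iterBlockOf n w)) ≤ δ₁ n)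
    (h₂ : ∀ n, n < k → ∀ w ∈ S, dist1 (radialHol (Averaging.iter av n (gaugeAct g₂ U)) (iterBlockOf (n + 1) w) (iterBlockOf n w)) ≤ δ₂ n)
    (hE : ∀ m, m < k → δ₂ m + δ₁ m ≤ ω / 2 * θ ^ (k - (m + 1))) :
    ∀ t, t ≤ k → ∀ w ∈ S,
      dist1 ((g₁ (embIter t (iterBlockOf t w)) * (g₂ (embIter t (iterBlockOf t w)))⁻¹)⁻¹ * (g₁ w * (g₂ w)⁻¹)) ≤ ω * θ ^ (k - t) := by
  intro t ht w hw
  refine (dist1_descent_le av hk g₁ g₂ U S δ₁ δ₂ h₁ h₂ t ht w hw).trans ?_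
  calc ∑ m ∈ Finset.range t, (δ₂ m + δ₁ m) ≤ ∑ m ∈ Finset.range t, ω / 2 * θ ^ (k - (m + 1)) :=
        Finset.sum_le_sum fun m hm => hE m (lt_of_lt_of_le (Finset.mem_range.1 hm) ht)
    _ = ω / 2 * ∑ m ∈ Finset.range t, θ ^ (k - (m + 1)) := by rw [Finset.mul_sum]
    _ ≤ ω / 2 * (2 * θ ^ (k - t)) := mul_le_mul_of_nonneg_left (sum_geom_tail_le hθ0 hθ k t ht) (by positivity)
    _ = ω * θ ^ (k - t) := by ring

end Summit.QuantumFields.YangMills.BalabanUVNodes.N07TwoAxialTowersPointwiseOsc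

end
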